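import Summits.HodgeConjecture.HodgeConjecture.Theorems.NoetherLefschetzOneUpSummitGrantedFourfoldsCohomologicallyAlgebraicProducts
import Literature.AlgebraicGeometry.HodgeTheory.HolomorphicBundleChernCharacterProjectiveSpace
import Literature.AlgebraicGeometry.HodgeTheory.FermatOddDegreeRestriction

/-!
# Projective-space factors: `X × ℙᴺ` and `ℙᴺ × X` satisfy the Hodge conjecture for every
# cohomologically algebraic `X` (helper for crux `SummitGrantedFourfolds`, stmt-HodgeConjecture-14600)

Route `HodgeConjecture/NoetherLefschetzOneUp`, crux `SummitGrantedFourfolds` (stmt-HodgeConjecture-14600).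
Companion of `NoetherLefschetzOneUpSummitGrantedFourfoldsCohomologicallyAlgebraicProducts` (closure of
"every even class algebraic, odd cohomology zero" under `⊗`, and the Hodge conjecture for such
varieties): projective space `ℙᴺ_ℂ` is cohomologically algebraic — the tree's PROVED
`algebraicClasses_projectiveSpace_eq_top` (Voisin I §11.1.2: classes of linear subspaces) and
`subsingleton_complexBetti_projectiveSpace_of_odd` (Hatcher Thm. 2.35/3.19) — so the closure theorem
yields, UNCONDITIONALLY and in every dimension, `HodgeConjectureFor` for `X ⊗ ℙᴺ`, `ℙᴺ ⊗ X` (`X`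
cohomologically algebraic: products of `p_g = q = 0` surfaces, `b₁ = 0` curves, projective spaces),
e.g. `ℙᴺ × ℙᴹ`, `S × ℙᴺ` for an Enriques surface `S`, `(S₁ × S₂) × ℙᴺ`.

No definition, no named-fact hypothesis, no `sorry`.

References: Voisin, *Hodge Theory and Complex Algebraic Geometry I*, §11.1.2, Thm. 11.30; Voisin II,
Prop. 9.20 (proof, first display); Hatcher, *Algebraic Topology*, Thm. 2.35, Thm. 3.16, Thm. 3.19.
-/

-- `Summit.HodgeConjecture.HodgeConjecture.Theorems` is the mandated namespace (single-conjunct summit),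
-- which `linter.dupNamespace` flags; the lakefile turns the linter off tree-wide, restated here so
-- stand-alone elaboration is warning-free too.
set_option linter.dupNamespace false

noncomputable section

open CategoryTheory AlgebraicGeometry MonoidalCategory CartesianMonoidalCategory
open Literature.AlgebraicGeometry Literature.AlgebraicGeometry.Motives
open Literature.AlgebraicGeometry.HodgeTheory Literature.AlgebraicTopology.SingularHomology

namespace Summit.HodgeConjecture.HodgeConjecture.Theorems

namespace CohomologicallyAlgebraic

/-- **Projective space is cohomologically algebraic**: every even-degree class of `ℙᴺ_ℂ` is algebraic
(`algebraicClasses_projectiveSpace_eq_top`) and its odd cohomology vanishes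
(`subsingleton_complexBetti_projectiveSpace_of_odd`). [cite: VoisinHodgeI2002, §11.1.2]
[cite: HatcherAT2002, Thm. 3.19] -/
theorem cohomologicallyAlgebraic_projectiveSpace (N : ℕ) :
    (∀ k : ℕ, algebraicClasses (projectiveSpace N ℂ) k = ⊤) ∧
      ∀ k : ℕ, Subsingleton (complexBetti (projectiveSpace N ℂ) (2 * k + 1)) :=
  ⟨algebraicClasses_projectiveSpace_eq_top N,
    fun k ↦ subsingleton_complexBetti_projectiveSpace_of_odd N ⟨k, rfl⟩⟩

/-- **`X ⊗ ℙᴺ` is cohomologically algebraic and satisfies the Hodge conjecture, for `X` cohomologically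
algebraic** (smooth projective of dimension `d` with every even class algebraic and odd cohomology
zero). [cite: VoisinHodgeII2003, proof of Prop. 9.20 (first display)] [cite: VoisinHodgeI2002, §11.1.2] -/
theorem cohomologicallyAlgebraic_tensor_projectiveSpace {d : ℕ} {X : SchemeOver ℂ}
    (hX : IsSmoothProjective d X) (hev : ∀ k : ℕ, algebraicClasses X k = ⊤)
    (hodd : ∀ k : ℕ, Subsingleton (complexBetti X (2 * k + 1))) (N : ℕ) :
    (∀ k : ℕ, algebraicClasses (X ⊗ projectiveSpace N ℂ) k = ⊤) ∧
      (∀ k : ℕ, Subsingleton (complexBetti (X ⊗ projectiveSpace N ℂ) (2 * k + 1))) ∧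
      HodgeConjectureFor (d + N) (X ⊗ projectiveSpace N ℂ) := by
  have hP : IsSmoothProjective N (projectiveSpace N ℂ) := isSmoothProjective_projectiveSpace_holds ℂ N
  obtain ⟨hPev, hPodd⟩ := cohomologicallyAlgebraic_projectiveSpace N
  exact ⟨algebraicClasses_tensor_eq_top hX hP hev hodd hPev hPodd,
    subsingleton_complexBetti_tensor_odd hX hP hodd hPodd,
    hodgeConjectureFor_tensor hX hP hev hodd hPev hPodd⟩

/-- **`ℙᴺ ⊗ X` is cohomologically algebraic and satisfies the Hodge conjecture**, `X` cohomologically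
algebraic. [cite: VoisinHodgeII2003, proof of Prop. 9.20 (first display)] [cite: VoisinHodgeI2002, §11.1.2] -/
theorem cohomologicallyAlgebraic_projectiveSpace_tensor {d : ℕ} {X : SchemeOver ℂ}
    (hX : IsSmoothProjective d X) (hev : ∀ k : ℕ, algebraicClasses X k = ⊤)
    (hodd : ∀ k : ℕ, Subsingleton (complexBetti X (2 * k + 1))) (N : ℕ) :
    (∀ k : ℕ, algebraicClasses (projectiveSpace N ℂ ⊗ X) k = ⊤) ∧
      (∀ k : ℕ, Subsingleton (complexBetti (projectiveSpace N ℂ ⊗ X) (2 * k + 1))) ∧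
      HodgeConjectureFor (N + d) (projectiveSpace N ℂ ⊗ X) := by
  have hP : IsSmoothProjective N (projectiveSpace N ℂ) := isSmoothProjective_projectiveSpace_holds ℂ N
  obtain ⟨hPev, hPodd⟩ := cohomologicallyAlgebraic_projectiveSpace N
  exact ⟨algebraicClasses_tensor_eq_top hP hX hPev hPodd hev hodd,
    subsingleton_complexBetti_tensor_odd hP hX hPodd hodd,
    hodgeConjectureFor_tensor hP hX hPev hPodd hev hodd⟩

/-- **The Hodge conjecture for `ℙᴺ × ℙᴹ`** (cellular; the smallest instance of the closure theorem with
two projective-space factors). [cite: VoisinHodgeI2002, §11.1.2] -/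
theorem hodgeConjectureFor_projectiveSpace_tensor_projectiveSpace (N M : ℕ) :
    HodgeConjectureFor (N + M) (projectiveSpace N ℂ ⊗ projectiveSpace M ℂ) :=
  (cohomologicallyAlgebraic_tensor_projectiveSpace (isSmoothProjective_projectiveSpace_holds ℂ N)
    (cohomologicallyAlgebraic_projectiveSpace N).1 (cohomologicallyAlgebraic_projectiveSpace N).2 M).2.2

/-- **The Hodge conjecture for `S × ℙᴺ`, `S` a smooth projective surface with `p_g = 0` and `b₁ = 0`**
(e.g. `Enriques × ℙᴺ`), every `N`, every codimension. [cite: VoisinHodgeI2002, Thm. 11.30 and §11.1.2]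
[cite: VoisinHodgeII2003, proof of Prop. 9.20 (first display)] -/
theorem hodgeConjectureFor_surface_tensor_projectiveSpace {S : SchemeOver ℂ} (hS : IsSmoothProjective 2 S)
    (hpg : ∃ A : HodgeModel 2 S, Module.finrank ℂ ↥(A.hodgePQ 2 2 0) = 0)
    (hq : Subsingleton (complexBetti S 1)) (N : ℕ) :
    HodgeConjectureFor (2 + N) (S ⊗ projectiveSpace N ℂ) :=
  (cohomologicallyAlgebraic_tensor_projectiveSpace hS (algebraicClasses_eq_top_of_pg_zero hS hpg)
    (subsingleton_complexBetti_odd_of_b₁ hS hq) N).2.2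

/-- **The Hodge conjecture for `(S₁ × S₂) × ℙᴺ`, `S₁`, `S₂` surfaces with `p_g = 0`, `b₁ = 0`** — a
`(4 + N)`-fold, every codimension. [cite: VoisinHodgeI2002, Thm. 11.30 and §11.1.2]
[cite: VoisinHodgeII2003, proof of Prop. 9.20 (first display)] -/
theorem hodgeConjectureFor_surfaces_tensor_projectiveSpace {S₁ S₂ : SchemeOver ℂ}
    (h₁ : IsSmoothProjective 2 S₁) (h₂ : IsSmoothProjective 2 S₂)
    (hpg₁ : ∃ A : HodgeModel 2 S₁, Module.finrank ℂ ↥(A.hodgePQ 2 2 0) = 0)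
    (hq₁ : Subsingleton (complexBetti S₁ 1))
    (hpg₂ : ∃ A : HodgeModel 2 S₂, Module.finrank ℂ ↥(A.hodgePQ 2 2 0) = 0)
    (hq₂ : Subsingleton (complexBetti S₂ 1)) (N : ℕ) :
    HodgeConjectureFor (2 + 2 + N) ((S₁ ⊗ S₂) ⊗ projectiveSpace N ℂ) := by
  obtain ⟨hev, hodd, -⟩ := cohomologicallyAlgebraic_tensor_surfaces h₁ h₂ hpg₁ hq₁ hpg₂ hq₂
  exact (cohomologicallyAlgebraic_tensor_projectiveSpace (IsSmoothProjective.tensor_holds h₁ h₂) hev hodd N).2.2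

end CohomologicallyAlgebraic

end Summit.HodgeConjecture.HodgeConjecture.Theorems

end
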